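import Summits.ValiantsHypothesis.ValiantsHypothesis.Theorems.KPlusLogSqLawTropicalOrbitChainAbstract
import Summits.ValiantsHypothesis.ValiantsHypothesis.Theorems.KPlusLogSqLawTropicalSymmetricThreeRowPairwise

/-!
# Tropical census, symmetric `3 × 3` designs — the two PARITY rules of an alternating orbit chain (P1: equal signs, P2: Lemma-Z product)

HONEST FRAMING.  Helper file (seat val-sym-lift-p2 (g7), cell `pub-symmetroid`, 2026-08-27; `--supports` the `WeakLifting` item
stmt-ValiantsHypothesis-19561 as a helper, no closure claim).  Pure lemma file: the SIGN layer of the abstract orbit-chain interface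
(`…TropicalOrbitChainAbstract`), in the shape of Lemma Z's `parity` (p492201) but without adjacency.  Abstract sign data along a chain
`r : Fin (n+1) → carriers × rank columns`: `s a ≠ 0` the sign of the `a`-th term, `A k c` the sign of the diagonal letter of rank `c` in
column `k`; an identity term has sign `∏_k A k (rank at k)` (`hD`); a non-identity term fixing column `k` has the strict sign of
`−A k (rank at k)` (`hT`); consecutive signs alternate (`halt`).  Consequences:
* `signChain_alt` — `s a · s b · (−1)^(a+b) > 0` for all positions `a, b` (alternation integrated);
* **`signChain_P1`** — two non-identity terms fixing the same column with the same rank there sit at positions of EQUAL parity;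
* **`signChain_P2`** — an identity term `D(u)` and three non-identity terms fixing the three columns `κ0, κ1, κ2` with the ranks of `u` there
  sit at positions `e, a0, a1, a2` with `e + a0 + a1 + a2` ODD (the four signs have negative product).
* instantiation for a concrete alternating orbit chain of a symmetric `3 × 3` design: `orbitChain_signD`, `orbitChain_signT`
  (`termSign_one_eq`, `termSign_swap_symm_three`, shapes from `isOrbitDominant_symm_three_shape`).
Together with the T-triple rule (`…TropicalOrbitTripleRule`) these are the ingredients beyond the pairwise rules that the cell's value
«T^orb_sym(3,4) ≤ 16» needs (seat enumeration, one code: the pairwise rules + T-triple leave sign-free 18-chains exactly on COMBO-BOUND's six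
R2 = 18 chambers, all killed by P1 or P2).  Nothing here is a census numeral: tropical objects bound no real pencil; `TSymOrb34Le16` stays a
target (NOT asserted here); ζ_sym(3,4) ∈ {18,19}, DoorA34 / DoorA26 (OPEN, typed, never asserted) untouched; nothing on `TropicalB` /
`WeakLifting` as closed, on `MatrixDescartes` (stmt-ValiantsHypothesis-18050) or on VP ≠ VNP.  [folklore] (sign bookkeeping; seat val-sym-lift-p2 g7)
-/

-- `Summit.ValiantsHypothesis.ValiantsHypothesis.…` is the tree's mandated single-conjunct layout (Sub = Summit).
set_option linter.dupNamespace false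
set_option autoImplicit false

namespace Summit.ValiantsHypothesis.ValiantsHypothesis.Theorems.LacunarySymmetroidMatrixDescartes.TropicalCensus.Orbit

open Summit.ValiantsHypothesis.ValiantsHypothesis.Theorems.MatrixDescartes.Negative
open Summit.ValiantsHypothesis.ValiantsHypothesis.Theorems.LacunarySymmetroidMatrixDescartes
open Summit.ValiantsHypothesis.ValiantsHypothesis.Theorems.LacunarySymmetroidMatrixDescartes.TropicalCensus
open Finset

variable {K : ℕ}

/-! ## Abstract sign data along a chain -/

section SignData

variable {n : ℕ} (r : Fin (n + 1) → Equiv.Perm (Fin 3) × (Fin 3 → Fin K)) (s : Fin (n + 1) → ℤ) (A : Fin 3 → Fin K → ℤ)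
  (hs0 : ∀ a, s a ≠ 0)
  (hD : ∀ a, (r a).1 = 1 → s a = ∏ k, A k ((r a).2 k))
  (hT : ∀ (a : Fin (n + 1)) (k : Fin 3), (r a).1 ≠ 1 → (r a).1 k = k → ∀ t : ℤ, s a * t < 0 ↔ -A k ((r a).2 k) * t < 0)
  (halt : ∀ k : Fin n, s k.castSucc * s k.succ < 0)

include hs0 halt in
/-- **Alternation integrated**: `s a · s b · (−1)^(a+b) > 0` for all positions. [induction on the distance] -/
theorem signChain_alt (a b : Fin (n + 1)) : 0 < s a * s b * (-1) ^ (a.val + b.val) := by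
  have main : ∀ (m : ℕ) (a b : Fin (n + 1)), b.val = a.val + m → 0 < s a * s b * (-1) ^ (a.val + b.val) := by
    intro m
    induction m with
    | zero =>
      intro a b hab
      have hb : b = a := Fin.ext (by omega)
      subst hb
      have he : Even (b.val + b.val) := ⟨b.val, rfl⟩
      rw [he.neg_one_pow, mul_one]
      exact mul_self_pos.mpr (hs0 b)
    | succ m ih =>
      intro a b hab
      have hbn : a.val + m < n := by have := b.isLt; omega
      let b' : Fin (n + 1) := ⟨a.val + m, by omega⟩
      have h1 := ih a b' rfl
      have h2 := halt ⟨a.val + m, hbn⟩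
      have e1 : (⟨a.val + m, hbn⟩ : Fin n).castSucc = b' := Fin.ext rfl
      have e2 : (⟨a.val + m, hbn⟩ : Fin n).succ = b := Fin.ext (by simp; omega)
      rw [e1, e2] at h2
      have eb : a.val + b.val = (a.val + b'.val) + 1 := by simp [b']; omega
      rw [eb, pow_succ]
      have h3 : s a * s b' * (-1) ^ (a.val + b'.val) * (s b' * s b) < 0 := mul_neg_of_pos_of_neg h1 h2
      have h4 : 0 < s b' * s b' := mul_self_pos.mpr (hs0 b')
      have e3 : s a * s b' * (-1) ^ (a.val + b'.val) * (s b' * s b) =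
          (s a * s b * (-1) ^ (a.val + b'.val)) * (s b' * s b') := by ring
      rw [e3] at h3
      rcases mul_neg_iff.mp h3 with ⟨_, hq⟩ | ⟨hp, _⟩
      · exact absurd hq (not_lt.mpr h4.le)
      · have e4 : s a * s b * ((-1) ^ (a.val + b'.val) * (-1)) = -(s a * s b * (-1) ^ (a.val + b'.val)) := by ring
        rw [e4]
        linarith
  rcases le_total a.val b.val with h | h
  · exact main (b.val - a.val) a b (by omega)
  · have := main (a.val - b.val) b a (by omega)
    have e : s b * s a * (-1) ^ (b.val + a.val) = s a * s b * (-1) ^ (a.val + b.val) := by rw [add_comm b.val]; ring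
    rwa [e] at this

include hs0 hT halt in
/-- **Rule P1**: two non-identity terms fixing the same column `k` with the same rank letter there have equal signs, hence positions of
equal parity. [sign of a transposition term = −(sign of its fixed diagonal letter); alternation] -/
theorem signChain_P1 (a b : Fin (n + 1)) (k : Fin 3) (ha1 : (r a).1 ≠ 1) (hak : (r a).1 k = k)
    (hb1 : (r b).1 ≠ 1) (hbk : (r b).1 k = k) (hx : (r a).2 k = (r b).2 k) : Even (a.val + b.val) := by
  by_contra hodd
  rw [Nat.not_even_iff_odd] at hodd
  have h0 := signChain_alt s hs0 halt a b
  rw [hodd.neg_one_pow] at h0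
  have hneg : s a * s b < 0 := by linarith
  set Q := A k ((r a).2 k) with hQ
  have h1 : -Q * s b < 0 := (hT a k ha1 hak (s b)).mp hneg
  have h2 := hT b k hb1 hbk Q
  rw [← hx, ← hQ] at h2
  -- `s b · Q > 0` from `h1`; then `h2` forces `−Q·Q < 0`, fine — but `h1` read through `hT a` also gives the sign of `s b` … contradiction:
  have h3 : s b * Q < 0 ∨ ¬ s b * Q < 0 := em _
  rcases h3 with h3 | h3
  · nlinarith [h1, h3]
  · have h4 : ¬ (-Q * Q < 0) := fun h => h3 (h2.mpr h)
    have hQ0 : Q ≠ 0 := by rintro hz; rw [hz] at h1; simp at h1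
    exact h4 (by nlinarith [mul_self_pos.mpr hQ0])

include hs0 hD hT halt in
/-- **Rule P2** (Lemma Z's product, adjacency-free): an identity term at `e` and three non-identity terms at `a0, a1, a2` fixing three
pairwise distinct columns `κ0, κ1, κ2` with the identity term's rank letters there have four signs of negative product, so
`e + a0 + a1 + a2` is odd. [termSign bookkeeping; alternation] -/
theorem signChain_P2 (e a0 a1 a2 : Fin (n + 1)) (κ0 κ1 κ2 : Fin 3) (h01 : κ0 ≠ κ1) (h02 : κ0 ≠ κ2) (h12 : κ1 ≠ κ2)
    (he1 : (r e).1 = 1)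
    (h0 : (r a0).1 ≠ 1 ∧ (r a0).1 κ0 = κ0 ∧ (r a0).2 κ0 = (r e).2 κ0)
    (h1 : (r a1).1 ≠ 1 ∧ (r a1).1 κ1 = κ1 ∧ (r a1).2 κ1 = (r e).2 κ1)
    (h2 : (r a2).1 ≠ 1 ∧ (r a2).1 κ2 = κ2 ∧ (r a2).2 κ2 = (r e).2 κ2) :
    Odd (e.val + a0.val + a1.val + a2.val) := by
  set Q0 := A κ0 ((r e).2 κ0) with hQ0
  set Q1 := A κ1 ((r e).2 κ1) with hQ1
  set Q2 := A κ2 ((r e).2 κ2) with hQ2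
  have hP : s e = Q0 * Q1 * Q2 := by
    rw [hD e he1, hQ0, hQ1, hQ2]
    exact prod_three h01 (Ne.symm h02) (Ne.symm h12) (fun k => A k ((r e).2 k))
  have hse := hs0 e
  rw [hP] at hse
  have q0 : Q0 ≠ 0 := fun h => hse (by rw [h]; ring)
  have q1 : Q1 ≠ 0 := fun h => hse (by rw [h]; ring)
  have q2 : Q2 ≠ 0 := fun h => hse (by rw [h]; ring)
  -- each crossing term has the strict sign of `−Q_i`
  have n0 : s a0 * Q0 < 0 := by
    have h := hT a0 κ0 h0.1 h0.2.1 Q0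
    rw [h0.2.2, ← hQ0] at h
    exact h.mpr (by nlinarith [mul_self_pos.mpr q0])
  have n1 : s a1 * Q1 < 0 := by
    have h := hT a1 κ1 h1.1 h1.2.1 Q1
    rw [h1.2.2, ← hQ1] at h
    exact h.mpr (by nlinarith [mul_self_pos.mpr q1])
  have n2 : s a2 * Q2 < 0 := by
    have h := hT a2 κ2 h2.1 h2.2.1 Q2
    rw [h2.2.2, ← hQ2] at h
    exact h.mpr (by nlinarith [mul_self_pos.mpr q2])
  have hN : (s a0 * Q0) * (s a1 * Q1) * (s a2 * Q2) < 0 := mul_neg_of_pos_of_neg (mul_pos_of_neg_of_neg n0 n1) n2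
  -- alternation integrated between `e` and each `a_i`
  have z0 := signChain_alt s hs0 halt e a0
  have z1 := signChain_alt s hs0 halt e a1
  have z2 := signChain_alt s hs0 halt e a2
  have Z : 0 < (s e * s a0 * (-1) ^ (e.val + a0.val)) * (s e * s a1 * (-1) ^ (e.val + a1.val)) *
      (s e * s a2 * (-1) ^ (e.val + a2.val)) := mul_pos (mul_pos z0 z1) z2
  have eZ : (s e * s a0 * (-1) ^ (e.val + a0.val)) * (s e * s a1 * (-1) ^ (e.val + a1.val)) *
      (s e * s a2 * (-1) ^ (e.val + a2.val)) =
      (s e * s e) * ((s a0 * Q0) * (s a1 * Q1) * (s a2 * Q2)) *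
        ((-1) ^ (e.val + a0.val) * (-1) ^ (e.val + a1.val) * (-1) ^ (e.val + a2.val)) := by
    rw [hP]; ring
  rw [eZ] at Z
  by_contra hev
  rw [Nat.not_odd_iff_even] at hev
  have hev' : Even ((e.val + a0.val) + (e.val + a1.val) + (e.val + a2.val)) := by
    obtain ⟨t, ht⟩ := hev
    exact ⟨t + e.val, by omega⟩
  have hχ : ((-1 : ℤ) ^ (e.val + a0.val) * (-1) ^ (e.val + a1.val) * (-1) ^ (e.val + a2.val)) = 1 := by
    rw [← pow_add, ← pow_add]
    exact hev'.neg_one_pow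
  rw [hχ, mul_one] at Z
  have hse2 : 0 < s e * s e := mul_self_pos.mpr (hs0 e)
  exact lt_asymm Z (mul_neg_of_pos_of_neg hse2 hN)

end SignData

/-! ## Instantiation: the sign data of a concrete alternating orbit chain of a symmetric `3 × 3` design -/

section Chain

variable (d : Fin K → ℕ) (v ε : Fin 3 → Fin 3 → Fin K → ℤ) (hv : ∀ i j l, v i j l = v j i l) (hε : ∀ i j l, ε i j l = ε j i l)
  {n : ℕ} (θ : Fin (n + 1) → ℤ) (p : Fin (n + 1) → Equiv.Perm (Fin 3) × (Fin 3 → Fin K))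
  (hdom : ∀ k, IsOrbitDominant d v ε (θ k) (p k))
include hv hε hdom

omit hv hε hdom in
/-- **`hD` for a concrete chain**: the sign of an identity term is the product of its diagonal letter signs, read through the sorting
bijection of the exponents. [termSign_one_eq] -/
theorem orbitChain_signD (a : Fin (n + 1)) (ha1 : (p a).1 = 1) :
    termSign ε (p a) = ∏ k, ε k k ((Tuple.sort d) ((Tuple.sort d).symm ((p a).2 k))) := by
  simp only [Equiv.apply_symm_apply]
  have hpa : p a = ((p a).1, (p a).2) := rfl
  rw [hpa, ha1]
  exact termSign_one_eq ε (p a).2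

/-- **`hT` for a concrete chain**: a non-identity orbit-dominant term with a fixed column `k` is a cycle-constant transposition, and its
sign is the strict sign of `−ε_kk(letter at k)`. [isOrbitDominant_symm_three_shape, termSign_swap_mul_neg_iff] -/
theorem orbitChain_signT (a : Fin (n + 1)) (k : Fin 3) (hne : (p a).1 ≠ 1) (hk : (p a).1 k = k) (t : ℤ) :
    termSign ε (p a) * t < 0 ↔ -ε k k ((Tuple.sort d) ((Tuple.sort d).symm ((p a).2 k))) * t < 0 := by
  simp only [Equiv.apply_symm_apply]
  rcases isOrbitDominant_symm_three_shape d v ε hv hε (p a).1 (p a).2 (hdom a) with h | ⟨i, j, hij, hswap, hcc⟩ | h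
  · exact absurd h hne
  · have hki : k ≠ i := by
      intro hq; subst hq
      rw [hswap, Equiv.swap_apply_left] at hk
      exact (ne_of_lt hij) hk.symm
    have hkj : k ≠ j := by
      intro hq; subst hq
      rw [hswap, Equiv.swap_apply_right] at hk
      exact (ne_of_lt hij) hk
    have hpres : ε i j ((p a).2 i) ≠ 0 := by
      have := present_of_termSign_ne_zero ε (p a) (hdom a).1 j
      rw [hswap, Equiv.swap_apply_right, ← hcc] at this
      exact this
    have hpa : p a = ((p a).1, (p a).2) := rfl
    rw [hpa, hswap]
    exact termSign_swap_mul_neg_iff ε hε (ne_of_lt hij) hki hkj (p a).2 hcc hpres t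
  · exact absurd hk (h k)

end Chain

end Summit.ValiantsHypothesis.ValiantsHypothesis.Theorems.LacunarySymmetroidMatrixDescartes.TropicalCensus.Orbit
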